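import Summits.Ventures.Crystal3D.Theorems.StickyWulffConstantGenericWallFloorSealedStates
import Summits.Ventures.Crystal3D.Theorems.StickyWulffConstantGenericWallFloorStackWalkInjective
import HarnessLib

/-!
# `top ↦ end state` is injective for ANY steering vector (crux `GenericWallFloor`, stmt-Ventures-19480, line `WallLedgerG`;
# memo RISER-LEDGER-g8 §4 (a)(iii), HOME/wall-p1-g8/)

HONEST FRAMING. Venture `Summits/Ventures/Crystal3D` (cell `crystal3d-full`), helper `--supports` the crux
`GenericWallFloor` of `route-Ventures-StickyWulffConstant`, REGISTERED line `WallLedgerG`, open stub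
`stub_twoSlabAdhesion`.  Structure only (census-free); F-C1 not moved; NOT the crux, no ledger here.

`walkRun_start_injective` (`…StackWalkInjective`) needs the walkers' steering `z` to see the sample as a `z`-SLAB (`hS`, `hdeep`
in `z`-heights) — in effect `z ≈ e₃`; the tilted ledgers (`…InjectiveTilt{,Ref,Wide}`) push this to `‖z − e₃‖ ≤ 1/3`.  The SWEPT
steering of memo RISER-LEDGER-g8 (≈ 40°) needs injectivity with NO relation between `z` and the vertical.  Here it is:

* `walkRun_stuck` — a walker that has stopped never moves again (so a walker that moves at time `i` moved at all earlier times);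
* **`walkRun_back_line`** — the BACKWARD LINE: if a valid walker of the family `(A, u)` (bottom entry `⟨A, u, 0⟩`, any unit `z`
  with `u` `z`-steep, `u` rising in TRUE height: `0 < δ ≤ (A u)₂`) is at time `k` in the bottom state `(q, [⟨A,u,0⟩])` at a
  LATTICE ball `q` of the clamped bottom sample's column (`q₂ ≤ b − 1`, lateral radius `≤ r`, `r + (b − 1 − a)/δ ≤ ρ − 2`, floor
  `a`), and was not stopped before, then at every earlier time `k − j` it was at `(q − j·A u, [⟨A,u,0⟩])`: each backward step
  is FULL (`walkStep_cases`); a POP into such a state would need a twin cap at the lattice ball `q − (j+1)·A u`, excluded by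
  `not_twinCap_of_floor_sample` (`…SealedStates`); a PUSH leaves two levels.  No height monotonicity is used;
* **`walkRun_ne_start_steer`**, **`walkRun_start_injective_steer`** — hence a walker launched from a top `t′` of the inner
  sample never visits the start state of another top `t` (it would put `t = t′ + i·A u` on `t′`'s line inside the run-convex
  sample), and `t ↦ walkRun N (t + A u, [⟨A, u, 0⟩])` is injective on the tops — for every steering `z`.
WHAT THIS IS NOT: no ledger; the rim-counting and `hfar` parts of the swept ledger are separate; F-C1 not moved.
-/

noncomputable section

namespace Summit.Ventures.Crystal3D.Theorems

open Finset
open Literature.MathematicalPhysics.StatisticalMechanics (fccStacking)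
open scoped InnerProductSpace

variable {X : Finset (EuclideanSpace ℝ (Fin 3))}

/-! ### Stopped walkers stay put -/

/-- A walker that has stopped at time `τ` is in the same state at every later time. -/
theorem walkRun_stuck (z : EuclideanSpace ℝ (Fin 3)) (s : EuclideanSpace ℝ (Fin 3) × List WalkEntry) (τ : ℕ)
    (h : walkStep X z (walkRun X z τ s) = none) : ∀ k : ℕ, walkRun X z (τ + k) s = walkRun X z τ s
  | 0 => rfl
  | k + 1 => by
    rw [← add_assoc, walkRun_succ', walkRun_stuck z s τ h k, walkRun_succ_of_none X z 0 h]

/-- If the walker MOVES at time `i` (`walkStep ≠ none`), it moved at every earlier time. -/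
theorem walkStep_ne_none_of_later (z : EuclideanSpace ℝ (Fin 3)) (s : EuclideanSpace ℝ (Fin 3) × List WalkEntry)
    {τ i : ℕ} (hτi : τ ≤ i) (hi : walkStep X z (walkRun X z i s) ≠ none) : walkStep X z (walkRun X z τ s) ≠ none := by
  intro hτ
  obtain ⟨k, rfl⟩ := Nat.exists_eq_add_of_le hτi
  rw [walkRun_stuck z s τ hτ k] at hi
  exact hi hτ

/-! ### Lattice and lateral bookkeeping along a line -/

/-- `q − j·A u` stays on the moved lattice. -/
theorem sub_natCast_smul_mem_movedFcc (A : EuclideanSpace ℝ (Fin 3) ≃ₗᵢ[ℝ] EuclideanSpace ℝ (Fin 3))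
    (t₀ : EuclideanSpace ℝ (Fin 3)) {q u : EuclideanSpace ℝ (Fin 3)}
    (hq : q ∈ (fun p => A p + t₀) '' fccStacking 1 (Real.sqrt (2 / 3))) (hu : u ∈ fccSlots) (j : ℕ) :
    q - (j : ℝ) • A u ∈ (fun p => A p + t₀) '' fccStacking 1 (Real.sqrt (2 / 3)) := by
  obtain ⟨s, hs, rfl⟩ := hq
  refine ⟨s + (j : ℝ) • (-u), add_natCast_smul_mem_fcc hs (mem_fcc_of_mem_fccSlots (neg_mem_fccSlots hu)) j, ?_⟩
  simp only [map_add, map_smul, map_neg, smul_neg]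
  abel

/-- Lateral radius along a unit line: `(q − j·v)₀² + (q − j·v)₁² ≤ (r + j)²` if `q`'s is `≤ r²` and `‖v‖ = 1`. -/
theorem lateral_sq_sub_natCast_smul_le {q v : EuclideanSpace ℝ (Fin 3)} {r : ℝ} (hr : 0 ≤ r) (hv : ‖v‖ = 1)
    (hq : q 0 ^ 2 + q 1 ^ 2 ≤ r ^ 2) : ∀ j : ℕ, (q - (j : ℝ) • v) 0 ^ 2 + (q - (j : ℝ) • v) 1 ^ 2 ≤ (r + j) ^ 2
  | 0 => by simpa using hq
  | j + 1 => by
    have ih := lateral_sq_sub_natCast_smul_le hr hv hq j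
    have h := lateral_sq_add_le (q - (j : ℝ) • v) (-v) (by positivity : (0 : ℝ) ≤ r + j) ih
    rw [norm_neg, hv] at h
    have e : q - (j : ℝ) • v + -v = q - ((j + 1 : ℕ) : ℝ) • v := by push_cast; module
    rw [e] at h
    convert h using 1; push_cast; ring

section Steer

variable (hX : ∀ p ∈ X, ∀ q ∈ X, p ≠ q → 1 ≤ dist p q)
  {s₀ : EuclideanSpace ℝ (Fin 3)} (hs₀ : s₀ ∈ fccSlots)
  (hcert : ExactOnly 0 (fccSlots.filter fun w => 0 < ⟪w, s₀⟫_ℝ))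
  {z : EuclideanSpace ℝ (Fin 3)} (hz : ‖z‖ = 1)
  (A : EuclideanSpace ℝ (Fin 3) ≃ₗᵢ[ℝ] EuclideanSpace ℝ (Fin 3)) (t₀ : EuclideanSpace ℝ (Fin 3))
  {u : EuclideanSpace ℝ (Fin 3)} (hu : u ∈ fccSlots) (hsteep : Real.sqrt 2 / 2 ≤ ⟪A u, z⟫_ℝ)
  {δ : ℝ} (hδ : 0 < δ) (hup : δ ≤ (A u) 2)
  (P : Finset (EuclideanSpace ℝ (Fin 3))) {a b ρ r : ℝ} (hρ2 : 2 ≤ ρ) (hab : a + 2 ≤ b) (hPX : P ⊆ X)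
  (hP : ∀ p, p ∈ P ↔ (p ∈ (fun q => A q + t₀) '' fccStacking 1 (Real.sqrt (2 / 3)) ∧
    a ≤ p 2 ∧ p 2 ≤ b ∧ p 0 ^ 2 + p 1 ^ 2 ≤ ρ ^ 2))
  (hfloor : ∀ q ∈ X, a ≤ q 2) (hr : 0 ≤ r) (hroom : r + (b - 1 - a) / δ ≤ ρ - 2)

include hX hs₀ hcert hz hu hδ hup hρ2 hab hPX hP hfloor hr hroom in
/-- **The backward line.**  `s` valid (`WalkInv`, `StackWF`), at time `k` in the bottom state at a lattice ball `q` of the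
bottom sample's column (`q₂ ≤ b − 1`, lateral radius `≤ r`), having moved at every time `< k`: then for every `j ≤ k` the
state at time `k − j` is `(q − j·A u, [⟨A, u, 0⟩])`. -/
theorem walkRun_back_line {s : EuclideanSpace ℝ (Fin 3) × List WalkEntry} (hI : WalkInv X z s) (hW : StackWF z s.2)
    {k : ℕ} {q : EuclideanSpace ℝ (Fin 3)} (hq : walkRun X z k s = (q, [⟨A, u, 0⟩]))
    (hqΛ : q ∈ (fun p => A p + t₀) '' fccStacking 1 (Real.sqrt (2 / 3))) (hqb : q 2 ≤ b - 1)
    (hqr : q 0 ^ 2 + q 1 ^ 2 ≤ r ^ 2) (hmoves : ∀ τ, τ < k → walkStep X z (walkRun X z τ s) ≠ none) :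
    ∀ j, j ≤ k → walkRun X z (k - j) s = (q - (j : ℝ) • A u, [⟨A, u, 0⟩]) := by
  have hAu : ‖A u‖ = 1 := by rw [LinearIsometryEquiv.norm_map, norm_eq_one_of_mem_fccSlots hu]
  intro j
  induction j with
  | zero => intro _; simpa using hq
  | succ j IH =>
    intro hjk
    have hj : j ≤ k := Nat.le_of_succ_le hjk
    have hprev := IH hj
    -- the state one step earlier
    set τ := k - (j + 1) with hτ
    have hτk : τ < k := by omega
    have hτ1 : k - j = τ + 1 := by omega
    obtain ⟨hIτ, hWτ⟩ := walkRun_valid hX hs₀ hcert hz τ hI hW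
    have hstep1 : walkRun X z 1 (walkRun X z τ s) = (q - (j : ℝ) • A u, [⟨A, u, 0⟩]) := by
      rw [← walkRun_succ', ← hτ1]; exact hprev
    -- it moved at time `τ`
    rcases hws : walkRun X z τ s with ⟨yw, stk⟩
    rw [hws] at hIτ hWτ hstep1
    cases hst : walkStep X z (yw, stk) with
    | none => exact absurd hst (by have := hmoves τ hτk; rwa [hws] at this)
    | some v =>
      rw [walkRun_succ_of_some X z 0 hst, walkRun_zero] at hstep1
      subst hstep1
      obtain ⟨hywX, hSw, ew, rw', hstk, -⟩ := hIτ
      simp only at hstk hSw hywX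
      subst hstk
      rcases walkStep_cases hst with ⟨-, hs⟩ | ⟨n, hcap, ⟨e', rest', hrr, hn, hs⟩ | ⟨-, hs⟩⟩
      · -- FULL: the predecessor is `q − (j+1)·A u` with the bottom stack
        injection hs with hy hl
        injection hl with hew hrw
        subst hew; subst hrw
        have hy : yw + A u = q - (j : ℝ) • A u := by first | exact hy | exact hy.symm
        have hyw : yw = q - ((j + 1 : ℕ) : ℝ) • A u := by
          rw [eq_sub_iff_add_eq] at hy ⊢
          rw [← hy]; push_cast; module
        rw [hyw]
      · -- POP: `yw = q − (j+1)·A u` would be a twin cap at a lattice ball of the sample column: impossible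
        exfalso
        subst hrr
        injection hs with hy hl
        injection hl with he' hrest
        subst he'
        have hy : yw + A u = q - (j : ℝ) • A u := by first | exact hy | exact hy.symm
        have hyw : yw = q - ((j + 1 : ℕ) : ℝ) • A u := by
          rw [eq_sub_iff_add_eq] at hy ⊢
          rw [← hy]; push_cast; module
        obtain ⟨hSo, hLi, -⟩ := hSw
        obtain ⟨hdir, hnn, hmenu₁, -, -, -, -⟩ := hSo
        subst hn
        -- the lower frame is `A`, the upper its twin across `ew.nrm`
        have hback : ∀ x, A x = ew.frame x - (2 * ⟪ew.frame x, ew.nrm⟫_ℝ) • ew.nrm := twin_symm A ew.frame hnn hLi.1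
        have hmenuA := menu_reflect ew.frame A hnn hmenu₁ hback
        -- `yw` is a lattice ball, below `b − 1`, off the rim by `2`
        have hywΛ : yw ∈ (fun p => A p + t₀) '' fccStacking 1 (Real.sqrt (2 / 3)) := by
          rw [hyw]; exact sub_natCast_smul_mem_movedFcc A t₀ hqΛ hu (j + 1)
        have hy2 : yw 2 = q 2 - ((j + 1 : ℕ) : ℝ) * (A u) 2 := by
          rw [hyw]; simp [PiLp.sub_apply, PiLp.smul_apply]
        have hjpos : (0 : ℝ) ≤ ((j + 1 : ℕ) : ℝ) := by positivity
        have hywb : yw 2 ≤ b - 1 := by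
          rw [hy2]; nlinarith [mul_nonneg hjpos (hδ.le.trans hup)]
        -- the number of backward steps is bounded by the floor: `(j+1)·δ ≤ b − 1 − a`
        have hya : a ≤ yw 2 := hfloor yw hywX
        have hsteps : ((j + 1 : ℕ) : ℝ) ≤ (b - 1 - a) / δ := by
          rw [le_div_iff₀ hδ]
          have h1 : ((j + 1 : ℕ) : ℝ) * δ ≤ ((j + 1 : ℕ) : ℝ) * (A u) 2 := mul_le_mul_of_nonneg_left hup hjpos
          linarith [hy2, hya, hqb]
        have hywr : yw 0 ^ 2 + yw 1 ^ 2 ≤ (ρ - 2) ^ 2 := by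
          have h1 := lateral_sq_sub_natCast_smul_le hr hAu hqr (j + 1)
          rw [← hyw] at h1
          have h2 : r + ((j + 1 : ℕ) : ℝ) ≤ ρ - 2 := by linarith
          have h3 : 0 ≤ r + ((j + 1 : ℕ) : ℝ) := by positivity
          exact h1.trans (by nlinarith)
        exact not_twinCap_of_floor_sample hX A t₀ P a b ρ hρ2 hab hPX hP hfloor hywΛ hywb hywr ew.frame hnn hmenuA
          hLi.1 ew.dir hcap
      · -- PUSH: two levels
        exfalso
        rw [pushMove_eq] at hs
        injection hs with _ hl
        injection hl with _ hl'
        first | exact List.cons_ne_nil _ _ hl' | exact List.cons_ne_nil _ _ hl'.symm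

include hX hs₀ hcert hz hu hsteep hδ hup hρ2 hab hPX hP hfloor hr hroom in
/-- **No walker visits the start state of another top — any steering.**  `S ⊆ P` the tops' region (balls FULL in `A`, height
`≤ b − 1`, lateral radius `≤ r`), run-convex along `A u`; if the walker launched from `t′ ∈ S` is at time `i` in the start state
`(t + A u, [⟨A,u,0⟩])` of a top `t ∈ S` (`t + A u ∉ S`... precisely: `t′` a top), then `t = t′`. -/
theorem walkRun_ne_start_steer (S : Finset (EuclideanSpace ℝ (Fin 3))) (hSP : S ⊆ P)
    (hS : ∀ p ∈ S, p 2 ≤ b - 1 ∧ p 0 ^ 2 + p 1 ^ 2 ≤ r ^ 2) (hfullS : ∀ p ∈ S, ∀ w ∈ fccSlots, p + A w ∈ X)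
    (hconv : ∀ p ∈ S, ∀ i : ℕ, 1 ≤ i → p + ((i : ℕ) : ℝ) • A u ∈ S → p + A u ∈ S)
    {t t' : EuclideanSpace ℝ (Fin 3)} (ht : t ∈ S) (ht' : t' ∈ S) (htop' : t' + A u ∉ S) :
    ∀ i : ℕ, walkRun X z i (t' + A u, [⟨A, u, 0⟩]) = (t + A u, [⟨A, u, 0⟩]) → t = t' := by
  intro i
  induction i with
  | zero =>
    intro h
    rw [walkRun_zero] at h
    exact (add_right_cancel (Prod.mk.inj h).1).symm
  | succ i IH =>
    intro h
    have ht'X : t' ∈ X := hPX (hSP ht')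
    have hI₀ : WalkInv X z (t' + A u, [⟨A, u, 0⟩]) := walkInv_start A ht'X (hfullS t' ht') hu hsteep
    have hW₀ : StackWF z ([⟨A, u, 0⟩] : List WalkEntry) := stackWF_start z A u
    rw [walkRun_succ'] at h
    obtain ⟨hwI, hwW⟩ := walkRun_valid hX hs₀ hcert hz i hI₀ hW₀
    rcases hws : walkRun X z i (t' + A u, [⟨A, u, 0⟩]) with ⟨yw, stk⟩
    rw [hws] at h hwI hwW
    cases hstep : walkStep X z (yw, stk) with
    | none =>
      rw [walkRun_succ_of_none X z 0 hstep] at h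
      exact IH (hws.trans h)
    | some v =>
      rw [walkRun_succ_of_some X z 0 hstep, walkRun_zero] at h
      subst h
      obtain ⟨-, hSw, ew, rw', hstk, -⟩ := hwI
      simp only at hstk hSw
      subst hstk
      rcases walkStep_cases hstep with ⟨-, hs⟩ | ⟨n, hcap, ⟨e', rest', hrr, hn, hs⟩ | ⟨-, hs⟩⟩
      · -- FULL: the walker was at `(t, bottom)` at time `i`, having moved at all times `≤ i`; run the backward line
        injection hs with hy hl
        injection hl with hew hrw
        subst hew; subst hrw
        have hy' : yw + A u = t + A u := by first | exact hy | exact hy.symm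
        have hyt : t = yw := (add_right_cancel hy').symm
        subst hyt
        have hmoves : ∀ τ, τ < i → walkStep X z (walkRun X z τ (t' + A u, [⟨A, u, 0⟩])) ≠ none := by
          intro τ hτ
          have hi : walkStep X z (walkRun X z i (t' + A u, [⟨A, u, 0⟩])) ≠ none := by rw [hws, hstep]; simp
          exact walkStep_ne_none_of_later z _ hτ.le hi
        have hline := walkRun_back_line hX hs₀ hcert hz A t₀ hu hδ hup P hρ2 hab hPX hP hfloor hr hroom hI₀ hW₀
          hws ((hP _).1 (hSP ht)).1 (hS _ ht).1 (hS _ ht).2 hmoves i le_rfl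
        rw [Nat.sub_self, walkRun_zero] at hline
        have hpos : t' + A u = t - (i : ℝ) • A u := (Prod.mk.inj hline).1
        -- so `t = t′ + (i+1)·A u` lies on `t′`'s line inside `S`: `t′` is not a top
        have hti : t' + (((i + 1 : ℕ)) : ℝ) • A u = t := by
          rw [eq_sub_iff_add_eq] at hpos
          rw [← hpos]; push_cast; module
        exact absurd (hconv t' ht' (i + 1) (by omega) (by rw [hti]; exact ht)) htop'
      · -- POP: `t` would be an exact cap of the twin frame, but `t` is full in `A`
        exfalso
        subst hrr
        injection hs with hy hl
        injection hl with he' hrest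
        subst he'
        have hy' : yw + A u = t + A u := by first | exact hy | exact hy.symm
        have hyt : t = yw := (add_right_cancel hy').symm
        subst hyt
        subst hn
        obtain ⟨hSo, hLi, -⟩ := hSw
        exact false_of_full_of_pop hX hSo hLi hcap (hfullS _ ht)
      · -- PUSH: the stack would have two levels
        exfalso
        rw [pushMove_eq] at hs
        injection hs with _ hl
        injection hl with _ hl'
        first | exact List.cons_ne_nil _ _ hl' | exact List.cons_ne_nil _ _ hl'.symm

include hX hs₀ hcert hz hu hsteep hδ hup hρ2 hab hPX hP hfloor hr hroom in
/-- **`top ↦ end state` is injective for any steering.**  Two tops of `S` whose walks are in the same state after `N` steps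
are equal. -/
theorem walkRun_start_injective_steer (S : Finset (EuclideanSpace ℝ (Fin 3))) (hSP : S ⊆ P)
    (hS : ∀ p ∈ S, p 2 ≤ b - 1 ∧ p 0 ^ 2 + p 1 ^ 2 ≤ r ^ 2) (hfullS : ∀ p ∈ S, ∀ w ∈ fccSlots, p + A w ∈ X)
    (hconv : ∀ p ∈ S, ∀ i : ℕ, 1 ≤ i → p + ((i : ℕ) : ℝ) • A u ∈ S → p + A u ∈ S)
    {t t' : EuclideanSpace ℝ (Fin 3)} (ht : t ∈ S) (htop : t + A u ∉ S) (ht' : t' ∈ S) (htop' : t' + A u ∉ S) {N : ℕ}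
    (h : walkRun X z N (t + A u, [⟨A, u, 0⟩]) = walkRun X z N (t' + A u, [⟨A, u, 0⟩])) : t = t' := by
  have hI : WalkInv X z (t + A u, [⟨A, u, 0⟩]) := walkInv_start A (hPX (hSP ht)) (hfullS t ht) hu hsteep
  have hI' : WalkInv X z (t' + A u, [⟨A, u, 0⟩]) := walkInv_start A (hPX (hSP ht')) (hfullS t' ht') hu hsteep
  rcases walkRun_eq_walkRun_orbit hX hs₀ hcert hz N hI (stackWF_start z A u) hI' (stackWF_start z A u) h with
    ⟨j, hj⟩ | ⟨j, hj⟩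
  · exact (walkRun_ne_start_steer hX hs₀ hcert hz A t₀ hu hsteep hδ hup P hρ2 hab hPX hP hfloor hr hroom S hSP hS hfullS hconv
      ht' ht htop j hj).symm
  · exact walkRun_ne_start_steer hX hs₀ hcert hz A t₀ hu hsteep hδ hup P hρ2 hab hPX hP hfloor hr hroom S hSP hS hfullS hconv
      ht ht' htop' j hj

end Steer

end Summit.Ventures.Crystal3D.Theorems

end
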